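import Mathlib
import Summits.RiemannHypothesis.RiemannHypothesis.Theses.WeilGroundState
import Summits.RiemannHypothesis.RiemannHypothesis.Theorems.GroundStateSimpleEven.Negative.LoadBearingAndParity
import Literature.NumberTheory.LFunctions.WeilGroundState
import Literature.NumberTheory.LFunctions.WeilSemilocalCompactnessProofs
import Summits.RiemannHypothesis.RiemannHypothesis.Theorems.WeilGroundStateGroundStateSimpleEvenStubCompact
import Summits.RiemannHypothesis.RiemannHypothesis.Theorems.WeilGroundStateGroundStateSimpleEvenStubPair
import HarnessLib

/-!
# Crux `GroundStateSimpleEven` (stmt-RiemannHypothesis-1526), line `parity-multiplicity-commutator`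
# (v2): the crux is equivalent to its odd branch

Support file (`--supports stmt-RiemannHypothesis-1526`): the sorry-free part of the v2 skeleton of
line `parity-multiplicity-commutator`, composed BY NAME from the landed stubs COMPACT
(`stub_evenGroundState_of_constrainedMinimisers`, p106119) and PAIR
(`stub_oddMinimisers_of_evenPair`), with the RH-strength stub ORDER kept as an explicit hypothesis.

## Results

* `weilWindowSimpleEven_of_oddSectorGap` — **window-wise halving theorem**: at a window `a > 0`, an
  odd-sector gap (`∃ δ > 0`, every `L²`-normalised ODD window test function has
  `Re Q ≥ ε(a) + δ`) already implies `WeilWindowSimpleEven a` (simple, isolated, even bottom), with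
  witness an even ground state.  Proof: the odd gap and `bottom_attained_in_a_sector` give even
  near-minimisers, COMPACT an even ground state `u₁`; if the even functions orthogonal to `u₁`
  reached `ε(a)`, COMPACT would give a second even ground state `u₂ ⊥ u₁` and PAIR an odd minimising
  sequence, contradicting the odd gap.
* `weilWindowSimpleEven_iff_oddSectorGap` — at every `a > 0`, `WeilWindowSimpleEven a` is
  EQUIVALENT to the odd-sector gap (the converse is the odd branch of the clause).
* `groundStateSimpleEven_of_oddSectorGap`, `groundStateSimpleEven_iff_oddSectorGap` — the crux
  `GroundStateSimpleEven` (route decl, by name) from / iff `∀ a > 0`, odd-sector gap at `a`.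
* `weilWindowSimpleEven_iff_groundStates_ae_even`, `groundStateSimpleEven_iff_groundStates_ae_even`
  — **evenness decides**: the window clause (resp. the crux) holds iff every ground state at the
  window (resp. at every window) is a.e. EVEN; simplicity and isolation are then automatic (odd gap
  ⟹ odd parts of minimising sequences die; conversely odd near-minimisers + CCM25 Thm 3.6
  compactness give an odd ground state).

So after this line the crux carries no content beyond the ORDER of the two parity sectors, which is
RH-strength as a `∀ a` statement (BarrierNotes-r1-k1 B1) and known for `a ≤ 1/100` (Suzuki 2026)
and `a = (log 2)/2` (item 1529).

Mathlib + proved tree files only; no definitions, no named facts, no `sorry`.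
-/

noncomputable section

open Set MeasureTheory Filter
open scoped Real Topology ComplexConjugate

namespace Summit.RiemannHypothesis.RiemannHypothesis.Theorems.GroundStateSimpleEven

open Literature.NumberTheory.LFunctions
open Summit.RiemannHypothesis.RiemannHypothesis.Theses.WeilGroundState
open Summit.RiemannHypothesis.Cruxes.GroundStateSimpleEven.Negative (bottom_attained_in_a_sector)

-- `linter.dupNamespace` off: the mandated namespace `Summit.RiemannHypothesis.RiemannHypothesis.…`
-- (single-problem summit) repeats a component.
set_option linter.dupNamespace false

variable {a : ℝ}

/-- **Window-wise halving theorem.** At a window `a > 0`, an odd-sector gap implies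
`WeilWindowSimpleEven a`: the bottom `ε(a)` is simple, isolated and even, with witness an even
ground state `u₁` (odd gap ⟹ even near-minimisers ⟹ even ground state by COMPACT; a second even
ground state orthogonal to it would yield odd minimisers by PAIR, contradicting the odd gap).
[folklore] -/
theorem weilWindowSimpleEven_of_oddSectorGap (ha : 0 < a)
    (horder : ∃ δ : ℝ, 0 < δ ∧ ∀ g : ℝ → ℂ, IsWeilTest g → tsupport g ⊆ Icc (-a) a →
      ∫ t, ‖g t‖ ^ 2 = (1 : ℝ) → (∀ t, g (-t) = -g t) →
        weilGroundEnergy a + δ ≤ (weilQuadratic g).re) :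
    WeilWindowSimpleEven a := by
  obtain ⟨δ₁, hδ₁, hodd⟩ := horder
  have hcompact := stub_evenGroundState_of_constrainedMinimisers a ha
  have hpair := stub_oddMinimisers_of_evenPair a ha
  -- (1) the odd sector is gapped, so the even sector attains `ε(a)`: even near-minimisers exist
  have hevenAtt : ∀ δ : ℝ, 0 < δ → ∃ g : ℝ → ℂ, IsWeilTest g ∧ tsupport g ⊆ Icc (-a) a ∧
      ∫ t, ‖g t‖ ^ 2 = (1 : ℝ) ∧ (∀ t, g (-t) = g t) ∧
      ∫ t, starRingEnd ℂ ((0 : ℝ → ℂ) t) * g t = 0 ∧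
      (weilQuadratic g).re < weilGroundEnergy a + δ := by
    intro δ hδ
    by_contra hne
    refine bottom_attained_in_a_sector ha (lt_min hδ hδ₁) (fun g hg hs hn hg' => ?_)
      (fun g hg hs hn hev => ?_)
    · have h1 := hodd g hg hs hn hg'
      have h2 := min_le_right δ δ₁
      linarith
    · by_contra hlt
      refine hne ⟨g, hg, hs, hn, hev, by simp, ?_⟩
      have h2 := min_le_left δ δ₁
      have h3 := not_le.1 hlt
      linarith
  -- (2) an even ground state `u₁` (COMPACT with the void constraint `w = 0`)
  obtain ⟨u₁, hu₁, hu₁ev, -⟩ := hcompact 0 MemLp.zero hevenAtt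
  -- (3) the even sector orthogonal to `u₁` is gapped
  have hgap : ∃ δ₂ : ℝ, 0 < δ₂ ∧ ∀ g : ℝ → ℂ, IsWeilTest g → tsupport g ⊆ Icc (-a) a →
      ∫ t, ‖g t‖ ^ 2 = (1 : ℝ) → (∀ t, g (-t) = g t) → ∫ t, starRingEnd ℂ (u₁ t) * g t = 0 →
      weilGroundEnergy a + δ₂ ≤ (weilQuadratic g).re := by
    by_contra hno
    have hnear : ∀ δ : ℝ, 0 < δ → ∃ g : ℝ → ℂ, IsWeilTest g ∧ tsupport g ⊆ Icc (-a) a ∧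
        ∫ t, ‖g t‖ ^ 2 = (1 : ℝ) ∧ (∀ t, g (-t) = g t) ∧ ∫ t, starRingEnd ℂ (u₁ t) * g t = 0 ∧
        (weilQuadratic g).re < weilGroundEnergy a + δ := by
      intro δ hδ
      by_contra hne
      refine hno ⟨δ, hδ, fun g hg hs hn hev horth => ?_⟩
      by_contra hlt
      exact hne ⟨g, hg, hs, hn, hev, horth, not_le.1 hlt⟩
    obtain ⟨u₂, hu₂, hu₂ev, horth⟩ := hcompact u₁ hu₁.memLp hnear
    obtain ⟨o, ho, hlim⟩ := hpair u₁ u₂ hu₁ hu₂ hu₁ev hu₂ev horth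
    have hge : ∀ n, weilGroundEnergy a + δ₁ ≤ (weilQuadratic (o n)).re :=
      fun n => hodd (o n) (ho n).1 (ho n).2.1 (ho n).2.2.1 (ho n).2.2.2
    have hle : weilGroundEnergy a + δ₁ ≤ weilGroundEnergy a := ge_of_tendsto' hlim hge
    linarith
  obtain ⟨δ₂, hδ₂, heven⟩ := hgap
  -- (4) witness `φ = u₁`, gap `min δ₁ δ₂`
  refine ⟨u₁, min δ₁ δ₂, lt_min hδ₁ hδ₂, fun g hg hs hn hpar => ?_⟩
  rcases hpar with hg' | ⟨hev, horth⟩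
  · have h1 := hodd g hg hs hn hg'
    have h2 := min_le_left δ₁ δ₂
    linarith
  · have h1 := heven g hg hs hn hev horth
    have h2 := min_le_right δ₁ δ₂
    linarith

/-- **Parity alone decides.** At every window `a > 0`, `WeilWindowSimpleEven a` (simple, isolated,
even bottom — the hypothesis of Connes–van Suijlekom 2025 Thm 6.1 at this window) is EQUIVALENT to
the odd-sector gap: some `δ > 0` puts every `L²`-normalised odd window test function at
`Re Q ≥ ε(a) + δ`. [folklore] -/
theorem weilWindowSimpleEven_iff_oddSectorGap (ha : 0 < a) :
    WeilWindowSimpleEven a ↔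
      ∃ δ : ℝ, 0 < δ ∧ ∀ g : ℝ → ℂ, IsWeilTest g → tsupport g ⊆ Icc (-a) a →
        ∫ t, ‖g t‖ ^ 2 = (1 : ℝ) → (∀ t, g (-t) = -g t) →
          weilGroundEnergy a + δ ≤ (weilQuadratic g).re := by
  refine ⟨fun h => ?_, weilWindowSimpleEven_of_oddSectorGap ha⟩
  obtain ⟨φ, δ, hδ, hH⟩ := h
  exact ⟨δ, hδ, fun g hg hs hn hodd => hH g hg hs hn (Or.inl hodd)⟩

/-- **The crux from its odd branch.** If at every window `a > 0` the odd sector is gapped, then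
`GroundStateSimpleEven` holds (route decl `…Theses.WeilGroundState.GroundStateSimpleEven`, by
name). [folklore] -/
theorem groundStateSimpleEven_of_oddSectorGap
    (horder : ∀ a : ℝ, 0 < a → ∃ δ : ℝ, 0 < δ ∧ ∀ g : ℝ → ℂ, IsWeilTest g →
      tsupport g ⊆ Icc (-a) a → ∫ t, ‖g t‖ ^ 2 = (1 : ℝ) → (∀ t, g (-t) = -g t) →
        weilGroundEnergy a + δ ≤ (weilQuadratic g).re) :
    Summit.RiemannHypothesis.RiemannHypothesis.Theses.WeilGroundState.GroundStateSimpleEven :=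
  fun a ha => weilWindowSimpleEven_of_oddSectorGap ha (horder a ha)

/-- **The crux is equivalent to its odd branch**: `GroundStateSimpleEven ↔ ∀ a > 0`, odd-sector gap
at `a`.  (The residue `∀ a`, ORDER is RH-strength: BarrierNotes-r1-k1 B1.) [folklore] -/
theorem groundStateSimpleEven_iff_oddSectorGap :
    Summit.RiemannHypothesis.RiemannHypothesis.Theses.WeilGroundState.GroundStateSimpleEven ↔
      ∀ a : ℝ, 0 < a → ∃ δ : ℝ, 0 < δ ∧ ∀ g : ℝ → ℂ, IsWeilTest g → tsupport g ⊆ Icc (-a) a →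
        ∫ t, ‖g t‖ ^ 2 = (1 : ℝ) → (∀ t, g (-t) = -g t) →
          weilGroundEnergy a + δ ≤ (weilQuadratic g).re :=
  ⟨fun h a ha => (weilWindowSimpleEven_iff_oddSectorGap ha).1 (h a ha),
    groundStateSimpleEven_of_oddSectorGap⟩

/-! ## Evenness of ground states decides -/

section Evenness

/-- **Under an odd-sector gap every ground state is a.e. even.** If at window `a` the odd sector is
gapped, every ground state `u` satisfies `u = u(-·)` a.e.: along a minimising sequence `gₙ → u`
the odd parts `oₙ → ½(u − u(-·))` have shifted forms `0 ≤ q(oₙ) ≤ q(gₙ) → 0`, while the gap gives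
`δ ∫|oₙ|² ≤ q(oₙ)`; hence `∫|½(u − u(-·))|² = lim ∫|oₙ|² = 0`. [folklore] -/
theorem groundState_ae_even_of_oddSectorGap
    (horder : ∃ δ : ℝ, 0 < δ ∧ ∀ g : ℝ → ℂ, IsWeilTest g → tsupport g ⊆ Icc (-a) a →
      ∫ t, ‖g t‖ ^ 2 = (1 : ℝ) → (∀ t, g (-t) = -g t) →
        weilGroundEnergy a + δ ≤ (weilQuadratic g).re)
    {u : ℝ → ℂ} (hu : IsWeilGroundState a u) : u =ᵐ[volume] fun t ↦ u (-t) := by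
  obtain ⟨δ, hδ, hodd⟩ := horder
  obtain ⟨huL, g, hg, hQ, hL⟩ := hu
  set ε : ℝ := weilGroundEnergy a with hε
  set o : ℕ → ℝ → ℂ := fun n t ↦ (g n t - g n (-t)) / 2 with ho
  set uo : ℝ → ℂ := fun t ↦ (u t - u (-t)) / 2 with huo
  have hgm : ∀ n, MemLp (g n) 2 := fun n ↦ ConnesVanSuijlekom.isWeilTest_memLp (hg n).1
  have hot : ∀ n, IsWeilTest (o n) := fun n ↦ isWeilTest_oddPart' (hg n).1
  have hos : ∀ n, tsupport (o n) ⊆ Icc (-a) a := fun n ↦ tsupport_oddPart_subset (hg n).2.1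
  have hoodd : ∀ n t, o n (-t) = -o n t := fun n t ↦ by
    simp only [ho, neg_neg]
    ring
  have huom : MemLp uo 2 := memLp_two_oddPart huL
  -- norms of the odd parts converge to `ν = ∫|uₒ|²`
  set ν : ℝ := ∫ t, ‖uo t‖ ^ 2 with hν
  have hN : Tendsto (fun n ↦ ∫ t, ‖o n t‖ ^ 2) atTop (𝓝 ν) :=
    ConnesVanSuijlekom.tendsto_integral_norm_sq huom
      (fun n ↦ ConnesVanSuijlekom.isWeilTest_memLp (hot n)) (tendsto_integral_norm_sq_oddPart huL hgm hL)
  -- shifted forms of the odd parts vanish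
  have hq : Tendsto (fun n ↦ (weilQuadratic (o n)).re - ε * ∫ t, ‖o n t‖ ^ 2) atTop (𝓝 0) := by
    have hup : Tendsto (fun n ↦ (weilQuadratic (g n)).re - ε * ∫ t, ‖g n t‖ ^ 2) atTop (𝓝 0) := by
      simp_rw [fun n ↦ (hg n).2.2, mul_one]
      have h := hQ.sub_const ε
      rwa [sub_self] at h
    refine tendsto_of_tendsto_of_tendsto_of_le_of_le tendsto_const_nhds hup (fun n ↦ ?_) fun n ↦ ?_
    · have := ConnesVanSuijlekom.weilGroundEnergy_mul_le_re (hot n) (hos n)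
      simp only
      linarith
    · exact shiftedForm_oddPart_le (hg n).1 (hg n).2.1
  -- the gap: `δ ∫|oₙ|² ≤ q(oₙ)`
  have hgap : ∀ n, δ * ∫ t, ‖o n t‖ ^ 2 ≤ (weilQuadratic (o n)).re - ε * ∫ t, ‖o n t‖ ^ 2 := by
    intro n
    set Nn : ℝ := ∫ t, ‖o n t‖ ^ 2 with hNn
    have hNn0 : 0 ≤ Nn := integral_nonneg fun _ ↦ by positivity
    rcases hNn0.eq_or_lt with h0 | hpos
    · -- `∫|oₙ|² = 0`: then `q(oₙ) ≥ 0 = δ · 0`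
      have := ConnesVanSuijlekom.weilGroundEnergy_mul_le_re (hot n) (hos n)
      rw [← h0]
      simp only [mul_zero, sub_zero]
      rw [← hNn, ← h0, mul_zero] at this
      exact this
    · set c : ℝ := (√Nn)⁻¹ with hc
      have hct : IsWeilTest fun t ↦ ((c : ℝ) : ℂ) * o n t := (hot n).const_mul _
      have hcs : tsupport (fun t ↦ ((c : ℝ) : ℂ) * o n t) ⊆ Icc (-a) a :=
        tsupport_mul_subset_right.trans (hos n)
      have hcn : ∫ t, ‖((c : ℝ) : ℂ) * o n t‖ ^ 2 = 1 := by
        simp only [norm_mul, mul_pow, Complex.norm_real, Real.norm_of_nonneg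
          (inv_nonneg.2 (Real.sqrt_nonneg _)), hc]
        rw [integral_const_mul, inv_pow, Real.sq_sqrt hpos.le]
        exact inv_mul_cancel₀ hpos.ne'
      have hco : ∀ t, ((c : ℝ) : ℂ) * o n (-t) = -(((c : ℝ) : ℂ) * o n t) := fun t ↦ by
        rw [hoodd, mul_neg]
      have h1 := hodd _ hct hcs hcn hco
      have h2 : (weilQuadratic fun t ↦ ((c : ℝ) : ℂ) * o n t).re = (weilQuadratic (o n)).re / Nn := by
        rw [weilQuadratic_const_mul, Complex.normSq_ofReal, Complex.re_ofReal_mul, hc, ← mul_inv,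
          Real.mul_self_sqrt hpos.le, inv_mul_eq_div]
      rw [h2, le_div_iff₀ hpos] at h1
      linarith
  -- hence `ν = 0`
  have hν0 : ν = 0 := by
    have hνnn : 0 ≤ ν := integral_nonneg fun _ ↦ by positivity
    have hlim : Tendsto (fun n ↦ δ * ∫ t, ‖o n t‖ ^ 2) atTop (𝓝 (δ * ν)) := hN.const_mul δ
    have hle : δ * ν ≤ 0 :=
      le_of_tendsto_of_tendsto' hlim hq hgap
    nlinarith
  -- so the odd part of `u` vanishes a.e.
  have hint : Integrable fun t ↦ ‖uo t‖ ^ 2 := (memLp_two_iff_integrable_sq_norm huom.1).1 huom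
  have hae := (integral_eq_zero_iff_of_nonneg (fun t ↦ by positivity) hint).1 hν0
  filter_upwards [hae] with t ht
  have h1 : ‖uo t‖ ^ 2 = 0 := ht
  have h2 : uo t = 0 := by simpa using h1
  simp only [huo] at h2
  linear_combination 2 * h2

/-- **If every ground state is a.e. even, the odd sector is gapped.** Otherwise odd normalised
window test functions `gₙ` with `Re Q(gₙ) → ε(a)` exist; by the compactness of the form
embedding (Connes–Consani–Moscovici 2025 Thm 3.6, proved in the tree) a subsequence converges in
`L²` to a ground state `u'`, which is then a.e. even by hypothesis and a.e. odd as a limit of odd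
functions, hence `0` — contradicting `∫|u'|² = 1`. [folklore] -/
theorem oddSectorGap_of_groundStates_ae_even (ha : 0 < a)
    (heven : ∀ u : ℝ → ℂ, IsWeilGroundState a u → u =ᵐ[volume] fun t ↦ u (-t)) :
    ∃ δ : ℝ, 0 < δ ∧ ∀ g : ℝ → ℂ, IsWeilTest g → tsupport g ⊆ Icc (-a) a →
      ∫ t, ‖g t‖ ^ 2 = (1 : ℝ) → (∀ t, g (-t) = -g t) →
        weilGroundEnergy a + δ ≤ (weilQuadratic g).re := by
  by_contra hno
  have hnear : ∀ δ : ℝ, 0 < δ → ∃ g : ℝ → ℂ, IsWeilTest g ∧ tsupport g ⊆ Icc (-a) a ∧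
      ∫ t, ‖g t‖ ^ 2 = (1 : ℝ) ∧ (∀ t, g (-t) = -g t) ∧
      (weilQuadratic g).re < weilGroundEnergy a + δ := by
    intro δ hδ
    by_contra hne
    refine hno ⟨δ, hδ, fun g hg hs hn hg' => ?_⟩
    by_contra hlt
    exact hne ⟨g, hg, hs, hn, hg', not_le.1 hlt⟩
  -- (1) an odd normalised minimising sequence
  have hseq : ∀ n : ℕ, ∃ g : ℝ → ℂ, IsWeilTest g ∧ tsupport g ⊆ Icc (-a) a ∧
      ∫ t, ‖g t‖ ^ 2 = (1 : ℝ) ∧ (∀ t, g (-t) = -g t) ∧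
      (weilQuadratic g).re < weilGroundEnergy a + 1 / ((n : ℝ) + 1) :=
    fun n ↦ hnear _ (by positivity)
  choose g hg hsupp hnorm hgodd hQlt using hseq
  have hQge : ∀ n, weilGroundEnergy a ≤ (weilQuadratic (g n)).re := fun n ↦ by
    have h := ConnesVanSuijlekom.weilGroundEnergy_mul_le_re (hg n) (hsupp n)
    rwa [hnorm n, mul_one] at h
  have hQ : Tendsto (fun n ↦ (weilQuadratic (g n)).re) atTop (𝓝 (weilGroundEnergy a)) := by
    have h1 : Tendsto (fun n : ℕ ↦ weilGroundEnergy a + 1 / ((n : ℝ) + 1)) atTop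
        (𝓝 (weilGroundEnergy a)) := by
      have h := (tendsto_one_div_add_atTop_nhds_zero_nat (𝕜 := ℝ)).const_add (weilGroundEnergy a)
      rwa [add_zero] at h
    exact tendsto_of_tendsto_of_tendsto_of_le_of_le tendsto_const_nhds h1 hQge fun n ↦ (hQlt n).le
  -- (2) compactness (CCM25 Thm. 3.6): an `L²`-convergent subsequence, whose limit is a ground state
  obtain ⟨u', hu', φ, hφ, hconv⟩ := ConnesConsaniMoscovici2025_thm_3_6_holds a ha g
    (fun n ↦ ⟨hg n, hsupp n, hnorm n⟩) hQ.bddAbove_range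
  have hgs : IsWeilGroundState a u' :=
    ⟨hu', fun n ↦ g (φ n), fun n ↦ ⟨hg (φ n), hsupp (φ n), hnorm (φ n)⟩, hQ.comp hφ.tendsto_atTop,
      hconv⟩
  -- (3) the limit is a.e. even (hypothesis) and a.e. odd (limit of odd functions)
  have hev := heven u' hgs
  have hgm : ∀ n, MemLp (g (φ n)) 2 := fun n ↦ ConnesVanSuijlekom.isWeilTest_memLp (hg (φ n))
  have hu'n : MemLp (fun t ↦ u' (-t)) 2 := memLp_two_comp_neg' hu'
  have hconvn : Tendsto (fun n ↦ ∫ t, ‖g (φ n) t - (-u' (-t))‖ ^ 2) atTop (𝓝 0) := by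
    refine hconv.congr fun n ↦ ?_
    rw [← integral_neg_eq_self (fun t ↦ ‖g (φ n) t - u' t‖ ^ 2) volume]
    congr 1 with t
    rw [hgodd]
    rw [show -g (φ n) t - u' (-t) = -(g (φ n) t - -u' (-t)) by ring, norm_neg]
  have hoddae : ∀ᵐ t : ℝ, u' t + u' (-t) = 0 := by
    have hb : ∀ n, ∫ t, ‖u' t - (-u' (-t))‖ ^ 2 ≤
        2 * (∫ t, ‖g (φ n) t - u' t‖ ^ 2) + 2 * ∫ t, ‖g (φ n) t - (-u' (-t))‖ ^ 2 := by
      intro n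
      have h := integral_norm_sq_sub_le_two_mul hu' hu'n.neg (hgm n)
      have e1 : ∀ t, ‖g (φ n) t - u' t‖ = ‖u' t - g (φ n) t‖ := fun t ↦ norm_sub_rev _ _
      have e2 : ∀ t, ‖g (φ n) t - (-u' (-t))‖ = ‖(-u' (-t)) - g (φ n) t‖ := fun t ↦ norm_sub_rev _ _
      simp_rw [e1, e2]
      simpa only [Pi.neg_apply] using h
    have hlim : Tendsto (fun n ↦ 2 * (∫ t, ‖g (φ n) t - u' t‖ ^ 2) +
        2 * ∫ t, ‖g (φ n) t - (-u' (-t))‖ ^ 2) atTop (𝓝 0) := by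
      simpa using (hconv.const_mul 2).add (hconvn.const_mul 2)
    have h0 : ∫ t, ‖u' t - (-u' (-t))‖ ^ 2 = 0 :=
      le_antisymm (ge_of_tendsto' hlim hb) (integral_nonneg fun _ ↦ by positivity)
    have hm : MemLp (fun t ↦ u' t - (-u' (-t))) 2 := hu'.sub hu'n.neg
    have hint : Integrable fun t ↦ ‖u' t - (-u' (-t))‖ ^ 2 :=
      (memLp_two_iff_integrable_sq_norm hm.1).1 hm
    have hae := (integral_eq_zero_iff_of_nonneg (fun t ↦ by positivity) hint).1 h0
    filter_upwards [hae] with t ht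
    have h1 : ‖u' t - (-u' (-t))‖ ^ 2 = 0 := ht
    have h2 : u' t - (-u' (-t)) = 0 := by simpa using h1
    linear_combination h2
  -- (4) hence `u' = 0` a.e., contradicting `∫|u'|² = 1`
  have hzero : u' =ᵐ[volume] 0 := by
    filter_upwards [hev, hoddae] with t h1 h2
    have h3 : u' t = u' (-t) := h1
    show u' t = 0
    linear_combination (h2 + h3) / 2
  have h1 : ∫ t, ‖u' t‖ ^ 2 = 0 := by
    rw [integral_congr_ae (hzero.mono fun t ht ↦ show ‖u' t‖ ^ 2 = (0 : ℝ → ℝ) t by simp [ht])]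
    simp
  have h2 := hgs.integral_norm_sq
  linarith

/-- **Evenness decides, window-wise.** At a window `a > 0`, `WeilWindowSimpleEven a` (simple,
isolated, even bottom) holds iff EVERY ground state at window `a` is a.e. even. [folklore] -/
theorem weilWindowSimpleEven_iff_groundStates_ae_even (ha : 0 < a) :
    WeilWindowSimpleEven a ↔
      ∀ u : ℝ → ℂ, IsWeilGroundState a u → u =ᵐ[volume] fun t ↦ u (-t) := by
  rw [weilWindowSimpleEven_iff_oddSectorGap ha]
  exact ⟨fun h _ hu ↦ groundState_ae_even_of_oddSectorGap h hu,
    oddSectorGap_of_groundStates_ae_even ha⟩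

/-- **Evenness decides.** The crux `GroundStateSimpleEven` — at every window the bottom of the
Weil form is simple, isolated and even (the hypothesis of Connes–van Suijlekom 2025, Thm 6.1) — is
EQUIVALENT to: at every window `a > 0`, every ground state is a.e. even.  Simplicity and isolation
are automatic. [folklore] -/
theorem groundStateSimpleEven_iff_groundStates_ae_even :
    Summit.RiemannHypothesis.RiemannHypothesis.Theses.WeilGroundState.GroundStateSimpleEven ↔
      ∀ a : ℝ, 0 < a → ∀ u : ℝ → ℂ, IsWeilGroundState a u → u =ᵐ[volume] fun t ↦ u (-t) :=
  ⟨fun h a ha ↦ (weilWindowSimpleEven_iff_groundStates_ae_even ha).1 (h a ha),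
    fun h a ha ↦ (weilWindowSimpleEven_iff_groundStates_ae_even ha).2 (h a ha)⟩

end Evenness

end Summit.RiemannHypothesis.RiemannHypothesis.Theorems.GroundStateSimpleEven

namespace Summit.RiemannHypothesis.RiemannHypothesis.Theorems

open Literature.NumberTheory.LFunctions

set_option linter.dupNamespace false in
/-- **Registered stub (HALVING) of line `parity-multiplicity-commutator` (v2): at every window
`a > 0` an odd-sector gap implies `WeilWindowSimpleEven a`** (simple, isolated, even bottom) —
COMPACT (p106119) and PAIR (p136135) discharged
(`GroundStateSimpleEven.weilWindowSimpleEven_of_oddSectorGap`). [folklore] -/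
theorem stub_weilWindowSimpleEven_of_oddSectorGap :
    ∀ a : ℝ, 0 < a →
      (∃ δ : ℝ, 0 < δ ∧ ∀ g : ℝ → ℂ, IsWeilTest g → tsupport g ⊆ Icc (-a) a →
        ∫ t, ‖g t‖ ^ 2 = (1 : ℝ) → (∀ t, g (-t) = -g t) →
          weilGroundEnergy a + δ ≤ (weilQuadratic g).re) →
      WeilWindowSimpleEven a :=
  fun _ ha horder => GroundStateSimpleEven.weilWindowSimpleEven_of_oddSectorGap ha horder

end Summit.RiemannHypothesis.RiemannHypothesis.Theorems

end
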